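import Literature.Computability.QuantumComplexity.JonesDigest
import Literature.Computability.Complexity.BrickAlgebra
import HarnessLib

/-!
# The post-processor of the AJL family (semantic definition), its specification, and the integer form of the decision rule

Topic `Literature/Computability/QuantumComplexity`; a step in the discharge of
`ajl_jonesApproxProblem_mem_PromiseBQP` (the classical post-processor of the core family of
`CoreFamily.lean`). On `⟨encode x, y⟩` the post-processor outputs the sampler's decision bit
computed from the counts of the test qubits read in `y` (`post`, `postSpec_post`). For the future
`FP` implementation we also restate the decision rule `AJLSampler.accept` (exact rational
arithmetic) as a comparison of integers (`accept_iff_int`), and assemble the conditional main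
theorem with the concrete processors (`mem_PromiseBQP_of_FP`): only `family.IsUniform`,
`digest ∈ FP` and `post ∈ FP` remain.

## References

* D. Aharonov, V. Jones, Z. Landau, Algorithmica 55 (2009), §3.3 and Thm. 1.2
  [AharonovJonesLandau2009].
-/

noncomputable section

namespace Literature.Computability.QuantumComplexity

open _root_.Computability Cryptography Complexity AJLSampler

namespace AJLCore

/-! ### The post-processor -/

/-- The size parameter read off the fields of an instance record `⟨bin n, ⟨word, ⟨bin θn, ⟨bin θd, 1^prec⟩⟩⟩⟩`
(total: every string is a record; `max (2·#letters + 2) (max prec 1)`, both in unary in the record). [folklore] -/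
def tOfRecord (a : List Bool) : ℕ :=
  max (2 * unaryDecodeNat (Brick.fstF (Brick.nthF 1 a)) + 2) (max (unaryDecodeNat (Brick.sndPow 3 a)) 1)

/-- **The post-processor** (a total closed form, ready for an `FP` implementation by the tree's
bricks): read `θn, θd, prec` and the size parameter off the instance record in the first
component, count the test qubits of both types in the second, output the decision bit.
[cite: AharonovJonesLandau2009, §3.3] -/
def post (w : List Bool) : List Bool :=
  [accept (decodeNat (Brick.nthF 2 (Brick.fstF w))) (decodeNat (Brick.nthF 3 (Brick.fstF w))) (unaryDecodeNat (Brick.sndPow 3 (Brick.fstF w)))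
    (KOf (16 * tOfRecord (Brick.fstF w) ^ 2))
    (cnt (16 * tOfRecord (Brick.fstF w) ^ 2) (Brick.sndF w) false) (cnt (16 * tOfRecord (Brick.fstF w) ^ 2) (Brick.sndF w) true)]

/-- The fields of an encoded instance. [folklore] -/
theorem fields_encode (x : RawJonesInstance) :
    decodeNat (Brick.nthF 2 (RawJonesInstance.encoding.encode x)) = x.2.2.1 ∧
    decodeNat (Brick.nthF 3 (RawJonesInstance.encoding.encode x)) = x.2.2.2.1 ∧
    unaryDecodeNat (Brick.sndPow 3 (RawJonesInstance.encoding.encode x)) = x.prec ∧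
    tOfRecord (RawJonesInstance.encoding.encode x) = tI x := by
  obtain ⟨n, wd, θn, θd, prec⟩ := x
  simp only [RawJonesInstance.encoding, Encoding.pairBool, Encoding.listBool, tOfRecord, RawJonesInstance.prec, tI,
    Brick.nthF_succ_boolPair, Brick.nthF_zero_boolPair, Brick.sndPow_succ_boolPair, Brick.sndPow_zero_boolPair, Brick.fstF_boolPair]
  refine ⟨?_, ?_, unary_decode_encode_nat _, ?_⟩
  · exact decode_encodeNat _
  · exact decode_encodeNat _
  · have e2 : unaryDecodeNat (unaryEncodingNat.encode prec) = prec := unary_decode_encode_nat _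
    rw [e2, unary_decode_encode_nat]

/-- **The post-processor meets the specification** (with the digest of `JonesDigest.lean`). [cite: AharonovJonesLandau2009, §3.3] -/
theorem postSpec_post : PostSpec digest post := by
  refine ⟨fun x _ y => ?_⟩
  obtain ⟨h1, h2, h3, h4⟩ := fields_encode x
  rw [post, Brick.fstF_boolPair, Brick.sndF_boolPair, h1, h2, h3, h4, digest_encode, length_digestRaw]

/-! ### The decision rule over the integers -/

/-- **The decision rule as an integer comparison**: for `θd, prec, K > 0`,
`accept ⇔ K²·(2·prec·θn + θd)² ≤ (2·prec·θd)²·((K − 2cR)² + (K − 2cI)²)`.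
[cite: AharonovJonesLandau2009, §3.3 and Claim 3.3] -/
theorem accept_iff_int {θn θd prec K cR cI : ℕ} (hθd : 0 < θd) (hprec : 0 < prec) (hK : 0 < K) :
    accept θn θd prec K cR cI = true ↔
      ((K : ℤ) ^ 2 * (2 * prec * θn + θd) ^ 2 ≤ (2 * prec * θd : ℤ) ^ 2 * (((K : ℤ) - 2 * cR) ^ 2 + ((K : ℤ) - 2 * cI) ^ 2)) := by
  rw [accept, decide_eq_true_iff]
  have hθd' : (0 : ℚ) < θd := by exact_mod_cast hθd
  have hprec' : (0 : ℚ) < prec := by exact_mod_cast hprec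
  have hK' : (0 : ℚ) < K := by exact_mod_cast hK
  have hD : (0 : ℚ) < (2 * prec * θd * K) ^ 2 := by positivity
  -- clear denominators
  have e1 : ((θn : ℚ) / θd + 1 / (2 * prec)) ^ 2 * (2 * prec * θd * K) ^ 2 = (K : ℚ) ^ 2 * (2 * prec * θn + θd) ^ 2 := by
    field_simp
  have e2 : ((1 - 2 * (cR : ℚ) / K) ^ 2 + (1 - 2 * (cI : ℚ) / K) ^ 2) * (2 * prec * θd * K) ^ 2 =
      (2 * prec * θd : ℚ) ^ 2 * (((K : ℚ) - 2 * cR) ^ 2 + ((K : ℚ) - 2 * cI) ^ 2) := by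
    field_simp
  rw [← mul_le_mul_iff_of_pos_right hD, e1, e2]
  constructor
  · intro h; exact_mod_cast h
  · intro h; exact_mod_cast h

/-! ### Assembly with the concrete processors -/

/-- **`jonesApproxProblem ∈ PromiseBQP`, given uniformity of the core family and polynomial-time
computability of the two concrete classical processors.** [cite: AharonovJonesLandau2009, Thm. 1.2] -/
theorem mem_PromiseBQP_of_FP (hU : family.IsUniform) (hd : digest ∈ FP) (hp : post ∈ FP) : ajl_jonesApproxProblem_mem_PromiseBQP :=
  mem_PromiseBQP_of_specs hU hd hp digestSpec_digest postSpec_post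

end AJLCore

end Literature.Computability.QuantumComplexity

end
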